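import Mathlib
import HarnessLib
import Literature.Analysis.FluidPDE.SelfSimilar
import Literature.Analysis.FluidPDE.VectorCalculus
import Literature.Analysis.FluidPDE.Vorticity
import Literature.Analysis.FluidPDE.AxisymmetricEuler
import Summits.NavierStokesRegularity.NavierStokesRegularity.Theses.ThreadingFlux

/-! # Sketch — crux idea «capsym-comparison» for `PoloidalLiouville` (stmt-NavierStokesRegularity-1222),
wall = registered stub `stub_scalarLiouville` of the antidynamo-v2 skeleton.  ns-idea-13 g0 (lens transfer).

First-lemma signatures only (Props, no proofs, no sorry).  Centre normalised to `x₀ = 0` and axis to `e₂`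
where a zonal comparison field is involved (the crux is translation/rotation covariant). -/

namespace Summit.NavierStokesRegularity.NavierStokesRegularity.Cruxes.PoloidalLiouville.CapSym

open scoped BigOperators Topology Classical InnerProductSpace RealInnerProductSpace
open Set Function MeasureTheory Literature.Analysis.FluidPDE

/-- (FL-A, support, S/M) **Vortical head potential.**  Frozen-time Poincaré lemma behind the conservative
form (★): if `∇L × (x − x₀) = ∇m × ∇T` off `x₀` (this is hypothesis (E1) of `StubScalarLiouville` with
`L = 𝓛T`, `m = ⟪v, x − x₀⟫`), then the field `L·(x − x₀) − m ∇T` is curl-free on the simply connected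
`ℝ³ ∖ {x₀}`, hence `= −∇Π` for a `C¹` "head" `Π`; tangentially `∇_S Π = m ∇_S T` (so `Π` and `m` are constant
on the vortex loops `{T = c} ∩ S_r`), radially `r·L = m ∂_r T − ∂_r Π`. -/
def HeadPotentialExists : Prop :=
  ∀ (x₀ : EuclideanSpace ℝ (Fin 3)) (L m T : EuclideanSpace ℝ (Fin 3) → ℝ),
    ContDiffOn ℝ 1 L ({x₀}ᶜ) → ContDiffOn ℝ 1 m ({x₀}ᶜ) → ContDiffOn ℝ 2 T ({x₀}ᶜ) →
    (∀ x, x ≠ x₀ → cross (gradient L x) (x - x₀) = cross (gradient m x) (gradient T x)) →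
    ∃ P : EuclideanSpace ℝ (Fin 3) → ℝ, ContDiffOn ℝ 1 P ({x₀}ᶜ) ∧
      ∀ x, x ≠ x₀ → (L x) • (x - x₀) = (m x) • gradient T x - gradient P x

/-- (FL-C, the comparison END-POINT, L) **Zonal toroidal Liouville = the linear heart of KNSS Thm 5.2.**
A bounded-with-derivatives zonal (axisymmetric about `e₂`) toroidal field `B = ∇U × x` (`U` a zonal scalar
potential) transported on `(−∞,0) × ℝ³` by a GIVEN smooth bounded divergence-free axisymmetric swirl-free
velocity `V` — induction equation in un-curled potential form `(∂ₜU + V·∇U − ΔU)·x = ⟪V,x⟫ ∇U − ∇Π` —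
vanishes identically.  Proof route: `η̃ := B_φ/ϖ` solves `∂ₜη̃ + V·∇η̃ = Δ₅ η̃` (the `SO(4)`-lift,
`AxisymmetricLiftR5`) with `|ϖ η̃| ≤ K`, and `KNSS2009_lemma21_halfball.eq_zero_of_abs_mul_le` ends it.
This is what the cap-symmetrised comparison flow must satisfy; KNSS 5.2 itself is the case `V = v`, `U = T`. -/
def ZonalToroidalLiouville : Prop :=
  ∀ (V : ℝ → EuclideanSpace ℝ (Fin 3) → EuclideanSpace ℝ (Fin 3)) (U P : ℝ → EuclideanSpace ℝ (Fin 3) → ℝ),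
    ContDiffOn ℝ (⊤ : ℕ∞) (uncurry V) (Iio 0 ×ˢ univ) →
    ContDiffOn ℝ (⊤ : ℕ∞) (uncurry U) (Iio 0 ×ˢ univ) →
    ContDiffOn ℝ 1 (uncurry P) (Iio 0 ×ˢ univ) →
    (∀ n : ℕ, ∃ C : ℝ, ∀ t < 0, ∀ x, ‖iteratedFDeriv ℝ n (V t) x‖ ≤ C) →
    (∀ t < 0, VectorCalculus.IsDivFree (V t)) →
    (∀ t < 0, IsAxisymmetric (V t)) → (∀ t < 0, HasNoSwirl (V t)) →
    (∀ t < 0, IsAxisymmetricScalar (U t)) →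
    (∀ n : ℕ, ∃ C : ℝ, ∀ t < 0, ∀ x,
        ‖iteratedFDeriv ℝ n (fun z => cross (gradient (U t) z) z) x‖ ≤ C) →
    (∀ t < 0, ∀ x,
        (deriv (fun s => U s x) t + inner ℝ (V t x) (gradient (U t) x) - Laplacian.laplacian (U t) x) • x
          = (inner ℝ (V t x) x) • gradient (U t) x - gradient (P t) x) →
    ∀ t < 0, ∀ x, cross (gradient (U t) x) x = 0

/-- (RUNG, first non-axisymmetric regime of the wall) **Unimodal scalar Liouville.**  `StubScalarLiouville`
restricted to potentials whose restriction to every sphere `S_r(x₀)` has connected super- and sub-level sets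
(one hill, one basin: the Reeb graph of `T|_{S_r}` is a segment), so that the loop functions `m = M(T,r,t)`,
`Π = P(T,r,t)` are single-valued on each sphere and the star-function inequality closes with no Reeb
correction.  Zonal monotone profiles (KNSS 5.2) are the equality case; tilted / non-axisymmetric one-hill
potentials are new territory. -/
def UnimodalScalarLiouville : Prop :=
  ∀ (v : ℝ → EuclideanSpace ℝ (Fin 3) → EuclideanSpace ℝ (Fin 3)) (x₀ : EuclideanSpace ℝ (Fin 3))
    (T : ℝ → EuclideanSpace ℝ (Fin 3) → ℝ),
    Literature.Analysis.FluidPDE.IsBoundedAncientMildSolution 1 v →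
    (∀ t < 0, AEStronglyMeasurable (v t) volume) →
    ContDiffOn ℝ (⊤ : ℕ∞) (Function.uncurry v) (Set.Iio 0 ×ˢ Set.univ) →
    ContDiffOn ℝ (⊤ : ℕ∞) (Function.uncurry T) (Set.Iio 0 ×ˢ ({x₀}ᶜ : Set (EuclideanSpace ℝ (Fin 3)))) →
    (∃ C : ℝ, ∀ t < 0, ∀ x, |T t x| ≤ C) →
    (∀ t < 0, ∀ x, curl (v t) x = cross (gradient (T t) x) (x - x₀)) →
    (∀ t < 0, ∀ x, x ≠ x₀ →
      cross (gradient (fun z => deriv (fun s => T s z) t + inner ℝ (v t z) (gradient (T t) z)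
          - Laplacian.laplacian (T t) z) x) (x - x₀)
        = cross (gradient (fun z => inner ℝ (v t z) (z - x₀)) x) (gradient (T t) x)) →
    (∀ t < 0, ∀ r > 0, ∀ c : ℝ,
        IsPreconnected {x | ‖x - x₀‖ = r ∧ c < T t x} ∧ IsPreconnected {x | ‖x - x₀‖ = r ∧ T t x < c}) →
    ∀ t < 0, ∀ x, cross (gradient (T t) x) (x - x₀) = 0

/-- (RUNG′ = BC5 witness, the first NON-axisymmetric regime where the transplant CLOSES BY ITSELF)
**Twisted-cap Liouville.**  `StubScalarLiouville` restricted to potentials that are cap-symmetric on every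
sphere about an axis `e(t,r) ∈ S²` which may TWIST with the radius and precess in time
(`T(t,x) = U(t,|y|, ⟪y/|y|, e(t,|y|)⟫)`, `y = x − x₀`, `U(t,r,·)` monotone on `[-1,1]`, `r‖∂_r e‖ ≤ A`).
KNSS 5.2 is the sub-case `e ≡ const`.  Mechanism (card §(6)): here the symmetrization deficit is exactly
`δ = |∂_r e|²·r I(s)² η♯/(4π)`, so (♠) reads `∂_t η♯ + V♯·∇η♯ − [Δ₅ + ½|∂_r e|² Δ_{S⁴}] η♯ = −|∂_r e|² η♯ ≤ 0`:
twisting acts as extra angular diffusion plus absorption, `η♯ ≥ 0` is a subsolution of a uniformly elliptic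
zonal operator (ellipticity ratio `1 + r²|∂_r e|²/2 ≤ 1 + A²/2`) without zeroth-order term, the KNSS weight
holds, and the sup-argument gives `η♯ ≡ 0`, i.e. `ω ≡ 0`. -/
def TwistedCapLiouville : Prop :=
  ∀ (v : ℝ → EuclideanSpace ℝ (Fin 3) → EuclideanSpace ℝ (Fin 3)) (x₀ : EuclideanSpace ℝ (Fin 3))
    (T : ℝ → EuclideanSpace ℝ (Fin 3) → ℝ),
    Literature.Analysis.FluidPDE.IsBoundedAncientMildSolution 1 v →
    (∀ t < 0, AEStronglyMeasurable (v t) volume) →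
    ContDiffOn ℝ (⊤ : ℕ∞) (Function.uncurry v) (Set.Iio 0 ×ˢ Set.univ) →
    ContDiffOn ℝ (⊤ : ℕ∞) (Function.uncurry T) (Set.Iio 0 ×ˢ ({x₀}ᶜ : Set (EuclideanSpace ℝ (Fin 3)))) →
    (∃ C : ℝ, ∀ t < 0, ∀ x, |T t x| ≤ C) →
    (∀ t < 0, ∀ x, curl (v t) x = cross (gradient (T t) x) (x - x₀)) →
    (∀ t < 0, ∀ x, x ≠ x₀ →
      cross (gradient (fun z => deriv (fun s => T s z) t + inner ℝ (v t z) (gradient (T t) z)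
          - Laplacian.laplacian (T t) z) x) (x - x₀)
        = cross (gradient (fun z => inner ℝ (v t z) (z - x₀)) x) (gradient (T t) x)) →
    (∃ (e : ℝ → ℝ → EuclideanSpace ℝ (Fin 3)) (U : ℝ → ℝ → ℝ → ℝ) (A : ℝ),
        ContDiffOn ℝ (⊤ : ℕ∞) (Function.uncurry e) (Set.Iio 0 ×ˢ Set.Ioi 0) ∧
        (∀ t < 0, ∀ r > 0, ‖e t r‖ = 1) ∧
        (∀ t < 0, ∀ r > 0, r * ‖deriv (fun ρ => e t ρ) r‖ ≤ A) ∧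
        (∀ t < 0, ∀ r > 0, MonotoneOn (U t r) (Set.Icc (-1) 1)) ∧
        (∀ t < 0, ∀ x, x ≠ x₀ →
          T t x = U t ‖x - x₀‖ (inner ℝ (x - x₀) (e t ‖x - x₀‖) / ‖x - x₀‖))) →
    ∀ t < 0, ∀ x, cross (gradient (T t) x) (x - x₀) = 0

/-! ## FL-B typed against concrete rearrangement objects on `S²` (answers P2 of the backstop verdict)

Everything below is stated for an abstract one-parameter family `f ρ : E³ → ℝ` (only its values on the unit sphere `𝕊` matter; in the
application `f ρ ξ = T t (x₀ + ρ • ξ)`, and the parameter is `ρ = r` or `ρ = t`), so the statements are pure calculus / geometry on `S²`,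
independent of Navier–Stokes.  `μH[d]` = `d`-dimensional Hausdorff measure on `E³`. -/

/-- The unit sphere of `E³` as a set. -/
def 𝕊 : Set (EuclideanSpace ℝ (Fin 3)) := Metric.sphere 0 1

/-- Superlevel set `{ξ ∈ S² : τ < f ξ}`. -/
def superlevel (f : EuclideanSpace ℝ (Fin 3) → ℝ) (τ : ℝ) : Set (EuclideanSpace ℝ (Fin 3)) := {ξ | ξ ∈ 𝕊 ∧ τ < f ξ}

/-- Spherical area (2-dimensional Hausdorff measure, as a real number). -/
noncomputable def area (A : Set (EuclideanSpace ℝ (Fin 3))) : ℝ := ((μH[2] : Measure (EuclideanSpace ℝ (Fin 3))) A).toReal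

/-- Distribution function `τ ↦ |{f > τ}|`. -/
noncomputable def distribution (f : EuclideanSpace ℝ (Fin 3) → ℝ) (τ : ℝ) : ℝ := area (superlevel f τ)

/-- Decreasing rearrangement `T*(s) = inf {τ : |{f > τ}| ≤ s}` (`0 ≤ s ≤ 4π`). -/
noncomputable def rearrangement (f : EuclideanSpace ℝ (Fin 3) → ℝ) (s : ℝ) : ℝ := sInf {τ : ℝ | distribution f τ ≤ s}

/-- Baernstein-type star function `k(s) = ∫₀ˢ T*(σ) dσ = sup_{|E| = s} ∫_E f`. -/
noncomputable def starFunction (f : EuclideanSpace ℝ (Fin 3) → ℝ) (s : ℝ) : ℝ := ∫ σ in (0:ℝ)..s, rearrangement f σ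

/-- The rank-`s` superlevel set `E_s = {f > T*(s)}` (area `s` at regular ranks). -/
noncomputable def rankSet (f : EuclideanSpace ℝ (Fin 3) → ℝ) (s : ℝ) : Set (EuclideanSpace ℝ (Fin 3)) :=
  superlevel f (rearrangement f s)

/-- The rank-`s` level loop `Γ_s = {f = T*(s)} ∩ S²`. -/
noncomputable def rankLoop (f : EuclideanSpace ℝ (Fin 3) → ℝ) (s : ℝ) : Set (EuclideanSpace ℝ (Fin 3)) :=
  {ξ | ξ ∈ 𝕊 ∧ f ξ = rearrangement f s}

/-- Tangential (spherical) gradient at `ξ ∈ S²` of a function given on `E³`. -/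
noncomputable def sphGrad (f : EuclideanSpace ℝ (Fin 3) → ℝ) (ξ : EuclideanSpace ℝ (Fin 3)) : EuclideanSpace ℝ (Fin 3) :=
  gradient f ξ - (inner ℝ (gradient f ξ) ξ) • ξ

/-- Laplace–Beltrami on `S²` of `f|_{S²}`, as the `E³`-Laplacian of the `0`-homogeneous extension, evaluated on the sphere. -/
noncomputable def sphLaplacian (f : EuclideanSpace ℝ (Fin 3) → ℝ) (ξ : EuclideanSpace ℝ (Fin 3)) : ℝ :=
  Laplacian.laplacian (fun x : EuclideanSpace ℝ (Fin 3) => f (‖x‖⁻¹ • x)) ξ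

/-- Total gradient on the rank-`s` loop, `Λ(s) = ∮_{Γ_s} |∇_ξ f| dℓ`. -/
noncomputable def loopGradient (f : EuclideanSpace ℝ (Fin 3) → ℝ) (s : ℝ) : ℝ :=
  ∫ ξ in rankLoop f s, ‖sphGrad f ξ‖ ∂(μH[1] : Measure (EuclideanSpace ℝ (Fin 3)))

/-- Isoperimetric profile of `S²` squared: `I(s)² = s(4π − s)` (perimeter² of a geodesic cap of area `s`). -/
noncomputable def isoSq (s : ℝ) : ℝ := s * (4 * Real.pi - s)

/-- Single-hill (unimodal) functions on `S²`: all super- and sub-level sets connected (Reeb graph a segment). -/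
def IsSingleHill (f : EuclideanSpace ℝ (Fin 3) → ℝ) : Prop :=
  ∀ c : ℝ, IsPreconnected {ξ | ξ ∈ 𝕊 ∧ c < f ξ} ∧ IsPreconnected {ξ | ξ ∈ 𝕊 ∧ f ξ < c}

/-- `s` is a regular rank of `f`: the tangential gradient does not vanish on `Γ_s`. -/
def IsRegularRank (f : EuclideanSpace ℝ (Fin 3) → ℝ) (s : ℝ) : Prop := ∀ ξ ∈ rankLoop f s, sphGrad f ξ ≠ 0

/-- `F` is a loop function of `f`: constant on the level sets of `f|_{S²}` (e.g. `m = ⟪v, x−x₀⟫` and the head `Π`, by (E1)). -/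
def FactorsThrough (F f : EuclideanSpace ℝ (Fin 3) → ℝ) : Prop := ∀ ξ ∈ 𝕊, ∀ ζ ∈ 𝕊, f ξ = f ζ → F ξ = F ζ

/-- Radial-envelope deficit (1.6) of the workfile: `δ_rad(s) = ∮_{Γ_s} (∂_ρ f − ∂_ρ T*)² dℓ/|∇_ξ f| ≥ 0`. -/
noncomputable def radialDeficit (f : ℝ → EuclideanSpace ℝ (Fin 3) → ℝ) (r s : ℝ) : ℝ :=
  ∫ ξ in rankLoop (f r) s,
    (deriv (fun ρ => f ρ ξ) r - deriv (fun ρ => rearrangement (f ρ) s) r) ^ 2 / ‖sphGrad (f r) ξ‖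
      ∂(μH[1] : Measure (EuclideanSpace ℝ (Fin 3)))

/-- (FL-B1, M) **Reynolds at fixed rank for loop functions** (workfile (1.4)/(2.3)/(3.3)/(4.1)): if `F ρ` is constant on the level loops of
`f ρ` for `ρ` near `r`, the `ρ`-derivative of `∫_{E_s(ρ)} F ρ` has NO boundary term — the moving-loop term is `𝔉(s,ρ)·∮ w dℓ = 0` by area
conservation.  Cases: `F = f` (`∂k = ∫_{E_s}∂f`, first-order exactness), `F = ρ·m` (transport compatibility `Φ = −r⁻¹∂_r(r𝔐)`, i.e.
`𝔡 = −r⁻¹∂_r(r𝔪)`), `F = Π` (head term exact). -/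
def FixedRankReynolds : Prop :=
  ∀ (F f : ℝ → EuclideanSpace ℝ (Fin 3) → ℝ) (r s : ℝ),
    ContDiff ℝ 2 (uncurry F) → ContDiff ℝ 2 (uncurry f) → 0 < s → s < 4 * Real.pi →
    (∀ᶠ ρ in 𝓝 r, IsSingleHill (f ρ) ∧ FactorsThrough (F ρ) (f ρ)) → IsRegularRank (f r) s →
    HasDerivAt (fun ρ => ∫ ξ in rankSet (f ρ) s, F ρ ξ ∂(μH[2] : Measure (EuclideanSpace ℝ (Fin 3))))
      (∫ ξ in rankSet (f r) s, deriv (fun ρ => F ρ ξ) r ∂(μH[2] : Measure (EuclideanSpace ℝ (Fin 3)))) r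

/-- (FL-B2, M) **Radial envelope with explicit deficit** (workfile (1.6)): `∂_ρ² k(s,ρ) = ∫_{E_s} ∂_ρ² f + δ_rad(s)`, `δ_rad ≥ 0` given by the
loop integral `radialDeficit`; `δ_rad = 0` iff `∂_ρ f` is itself a loop function. -/
def RadialEnvelopeDeficit : Prop :=
  ∀ (f : ℝ → EuclideanSpace ℝ (Fin 3) → ℝ) (r s : ℝ),
    ContDiff ℝ 3 (uncurry f) → 0 < s → s < 4 * Real.pi →
    (∀ᶠ ρ in 𝓝 r, IsSingleHill (f ρ) ∧ IsRegularRank (f ρ) s) →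
    HasDerivAt (fun ρ => deriv (fun ρ' => starFunction (f ρ') s) ρ)
      ((∫ ξ in rankSet (f r) s, iteratedDeriv 2 (fun ρ => f ρ ξ) r ∂(μH[2] : Measure (EuclideanSpace ℝ (Fin 3))))
        + radialDeficit f r s) r
    ∧ 0 ≤ radialDeficit f r s

/-- (FL-B3, M) **Spherical flux with isoperimetric deficit** (workfile (5.1)): Gauss on `E_s` gives `∫_{E_s} Δ_ξ f = −Λ(s)`, and
Cauchy–Schwarz against the coarea identity `∮_{Γ_s} dℓ/|∇_ξ f| = −1/∂_sT*` plus Lévy's isoperimetric inequality on `S²` give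
`Λ(s) ≥ I(s)²·(−∂_sT*(s))`; so `∫_{E_s}Δ_ξ f = I² k_ss − r²δ_S` with `δ_S ≥ 0`. -/
def SphericalFluxDeficit : Prop :=
  ∀ (f : EuclideanSpace ℝ (Fin 3) → ℝ) (s : ℝ),
    ContDiff ℝ 2 f → 0 < s → s < 4 * Real.pi → IsSingleHill f → IsRegularRank f s →
    (∫ ξ in rankSet f s, sphLaplacian f ξ ∂(μH[2] : Measure (EuclideanSpace ℝ (Fin 3)))) = - loopGradient f s
    ∧ isoSq s * (- deriv (rearrangement f) s) ≤ loopGradient f s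

/-- (FL-B4, M) **Rigidity of the equality case** («δ_S ≡ 0 ⟺ cap profile»): equality `Λ(s) = I(s)²(−∂_sT*)` at every rank forces every
level loop to be a geodesic circle carrying constant `|∇_ξ f|`, i.e. `f|_{S²}` is a monotone zonal (cap) profile about some axis. -/
def CapRigidity : Prop :=
  ∀ (f : EuclideanSpace ℝ (Fin 3) → ℝ),
    ContDiff ℝ 2 f → IsSingleHill f → (∀ s, 0 < s → s < 4 * Real.pi → IsRegularRank f s) →
    ((∀ s, 0 < s → s < 4 * Real.pi → loopGradient f s = isoSq s * (- deriv (rearrangement f) s)) ↔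
      ∃ (e : EuclideanSpace ℝ (Fin 3)) (U : ℝ → ℝ), ‖e‖ = 1 ∧ MonotoneOn U (Set.Icc (-1) 1) ∧
        ∀ ξ ∈ 𝕊, f ξ = U (inner ℝ ξ e))

end Summit.NavierStokesRegularity.NavierStokesRegularity.Cruxes.PoloidalLiouville.CapSym
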